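import Mathlib
import HarnessLib
import Literature.MathematicalPhysics.QuantumManyBody.BoseGasFreeDirichletBEC
import Literature.MathematicalPhysics.QuantumManyBody.BoseGasDirichletWall
import Summits.AtomisticToContinuum.BoseEinsteinCondensation.Theorems.HealingPivotCascadeEngineCore

/-!
# HealingPivotCascade — sub-cell Bessel bound `S_k ≤ N` (registered stub `stub_subcellBessel` of `RetentionCap`, stmt-32059)

The level-`k` dyadic coherent sum `∑_q occupation N (subMode (sideLength ρ N / 2^k) q) Ψ` of a trial state in the box of
side `sideLength ρ N` is at most `N`.  This is the statement `StubSubcellBessel` of the registered birth skeleton of the crux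
`RetentionCap` (route HealingPivotCascade, decomp-a2c lens-6 g9), unfolded, and is a direct corollary of the landed engine
lemma `HealingPivotCascadeEngineCore.subSum_le_card`.
-/

noncomputable section

namespace Summit.AtomisticToContinuum.BoseEinsteinCondensation.Theorems.HealingPivotCascadeSubcellBessel

open Literature.MathematicalPhysics.QuantumManyBody.BoseGas
open Summit.AtomisticToContinuum.BoseEinsteinCondensation.Theorems.HealingPivotCascadeEngineCore

/-- `StubSubcellBessel` of the `RetentionCap` birth skeleton, unfolded: every dyadic coherent sum is `≤ N`.
[corollary of `subSum_le_card`] -/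
theorem stub_subcellBessel :
    ∀ (ρ : ℝ) (N : ℕ), 0 < sideLength ρ N → ∀ Ψ : TrialState N (sideLength ρ N), ∀ k : ℕ,
      (∑ q : SubIdx (2 ^ k), occupation N (subMode (sideLength ρ N / 2 ^ k) q) Ψ.ψ) ≤ (N : ENNReal) := by
  intro ρ N hL Ψ k
  simpa [subSum] using subSum_le_card hL k Ψ

end Summit.AtomisticToContinuum.BoseEinsteinCondensation.Theorems.HealingPivotCascadeSubcellBessel

end
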